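import Summits.ResolutionOfSingularities.ResolutionOfSingularities.Theses.HilbertSamuelElimination
import Summits.ResolutionOfSingularities.ResolutionOfSingularities.Theorems.HilbertSamuelEliminationSigmaMaxModificationsReductionBase
import Summits.ResolutionOfSingularities.ResolutionOfSingularities.Theorems.HilbertSamuelEliminationSigmaMaxModificationsGradedGlue
import Summits.ResolutionOfSingularities.ResolutionOfSingularities.Theorems.HilbertSamuelEliminationSigmaMaxModificationsSurfaceNuMods
import Summits.ResolutionOfSingularities.ResolutionOfSingularities.Theorems.HilbertSamuelEliminationModificationsResolveDenseComplMaxLocus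
import Mathlib.AlgebraicGeometry.Morphisms.Proper
import Mathlib.AlgebraicGeometry.Noetherian
import Mathlib.FieldTheory.Perfect
import HarnessLib

/-!
# `SigmaMaxModificationsCorridor3` (crux stmt-ResolutionOfSingularities-19249, route
HilbertSamuelElimination) — line `tame_wild`: ν-WISE REGIME SPLIT BY `p`-TAMENESS OF THE MAXIMAL
HILBERT–SAMUEL VALUE (strategist, 2026-08-17; lens: transfer from characteristic zero)

**Crux.** `SigmaMaxModificationsCorridor3` (all levels `N ≥ 3`, threefolds with the corridor
condition at level `N`; body `HSBody X N`).

**Lever.** By the graded glue (landed `stub_gradedGlue`, CJS Def. 6.14 → 6.15) a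
`Σ^max`-modification at level `3` of every non-regular `Y` of the class `{dim ≤ 3}` follows from
`ν`-MODIFICATIONS: for each maximal value `ν ≠ Φ^{(3)}` of `Σ_Y(3)` separately, a proper
`π : Y' → Y` killing the value `ν`, an isomorphism off the stratum `Y(ν)`, `H^3` non-increasing.
The maximal value `ν` is a COMBINATORIAL DATUM, and it decides the local algebra of every point of
its stratum to first order: `ν = Φ^{(4)} - Φ^{(4)}(· - m)` (`hypersurfaceHF m`) iff every point
of `Y(ν)` is a hypersurface point of multiplicity `m` (embedding dimension `dim + 1`, tangent cone
a hypersurface of degree `m`; Bennett / CJS Thm. 2.3, Lemma 2.23). Split the maximal values: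

* `IsTameValue p ν` : `ν = hypersurfaceHF m` with `m < p` — the regime OWNED BY CHARACTERISTIC
  ZERO TECHNIQUE: at every point of `Y(ν)` a hypersurface of maximal contact exists (Giraud 1975:
  `ord < p`; tree `MarkedIdeal.exists_maximalContact_of_smooth` over perfect `k`) and persists
  under permissible blow-ups (tree `MaximalContactPersistence`, char-free), the `ν`-stratum and all
  its near points live in a regular THREEFOLD `W`, and by Tschirnhausen (`m` invertible) the
  `ν`-elimination problem is EQUIVALENT to the resolution of the coefficient marked ideal
  `(C(f), m!)` on `W` — a basic object on a regular threefold over a perfect field, the setting of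
  Cossart–Piltant 2008 Prop. 4.4 (tree fact `CossartPiltant2008_prop44`, `dim V(J) ≤ 1`),
  Benito–Villamayor 2012 (Math. Ann. 353, §4: two-dimensional hypersurfaces in smooth 3-folds over
  perfect fields) and Kawanoue–Matsuki 2012 (arXiv:1205.4556: idealistic filtrations with ambient
  dimension 3, local version). So `stub_tameNu3` is a TRANSFER stub: essentially in print modulo
  the global form of dim-3 Rees-algebra resolution over perfect fields; an XL vendoring /
  formalisation job, not an open problem of the summit's kind.
* the WILD residual `stub_wildNu3`: `p ∣`-type multiplicities (`m ≥ p`), non-hypersurface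
  maximal values, or imperfect `k` — exactly where every catalogued characteristic-`p` pathology
  lives (Narasimhan `ν = p`: `NarasimhanMaximalContact`; Moh/Hauser kangaroo points:
  `KangarooShadeIncrease`, `ResidualOrderUnbounded`; Cossart–Schober small-`p` directrix:
  `DirectrixSmallCharacteristic`) — and where nothing is in print. For `p = 2` every value is wild
  (`m < 2` is regular), matching CJS Rem. 6.29's obstruction O1.

Isolated strata (`Y(ν)` disjoint from `closure (Sing Y ∖ Y(ν))`) of either kind are
Cossart–Piltant 2019 ν-wise (`stub_isolatedNu3`, provable from the named fact); surfaces in the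
class are CJS ν-eliminations (landed `stub_nuMods_surface_of_nuFact` from the named ν-fact);
levels `N ≥ 4` by dimension-bounded level raising (`stub_levelRaiseDim`, shared with line
`corridor3_levels`). The composition `SigmaMaxModificationsCorridor3_of` is sorry-free.

**Why easier (transfer with teeth).** The parent crux's census (Cruxes/SigmaMaxModifications/
STRATEGY-CENSUS.md §Transfer) examined char-`p` PROJECTION methods (CP 2019, Cutkosky 2009,
Abhyankar) and found no transfer because their currency (local uniformization + patching) violates
(ME1)/`H`-monotonicity. This line transfers the char-ZERO method instead (maximal contact +
coefficient ideal + induction on ambient dimension), whose output IS a sequence of blow-ups in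
regular `H`-permissible centres inside the stratum — the currency of CJS Def. 6.14 — and which is
valid verbatim whenever the multiplicity is `< p` (Bierstone–Milman / BGMW Thm. 8.0.4: "the
algorithm in characteristic zero can be reproduced for multiplicities smaller than the
characteristic"). The new move is to index the regime split by the MAXIMAL VALUE `ν` (a datum the
graded glue already iterates over), so that tameness is a property of the stratum being killed,
uniform along it and stable under the near-point relation (`H` constant ⟹ `m` constant).

## Sources

* V. Cossart, U. Jannsen, S. Saito, LNM 2270 (2020): Thm. 2.3, Lemma 2.23, Def. 2.28,
  Rem. 2.29 (b), Def. 6.14/6.15, Rem. 6.24, Thm. 6.28, Rem. 6.29. [CossartJannsenSaito2020]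
* V. Cossart, O. Piltant, J. Algebra 529 (2019), Thm. 1.1. [CossartPiltant2019]
* V. Cossart, O. Piltant, J. Algebra 320 (2008), Prop. 4.4. [CossartPiltant2008]
* J. Giraud, Math. Z. 143 (1975) (contact maximal en caractéristique positive, `ord < p`).
* A. Benito, O. Villamayor, Math. Ann. 353 (2012) 1037–1068, §4 (arXiv:1103.3464).
* H. Kawanoue, K. Matsuki, arXiv:1205.4556 (2012), local version in ambient dimension 3.
* E. Bierstone, D. Grigoriev, P. Milman, J. Włodarczyk, arXiv:0806.4561, Thm. 8.0.4 / Cor. 8.0.6.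
-/

set_option linter.dupNamespace false -- mandated namespace of this single-conjunct summit

noncomputable section

open CategoryTheory AlgebraicGeometry TopologicalSpace Topology
open Literature.AlgebraicGeometry.Resolution Literature.RingTheory.HilbertSamuel
open Summit.ResolutionOfSingularities.ResolutionOfSingularities.Theses.HilbertSamuelElimination
open Summit.ResolutionOfSingularities.ResolutionOfSingularities.Theorems.SigmaMaxModifications.Sketch
open Summit.ResolutionOfSingularities.ResolutionOfSingularities.Theorems.ModificationsResolve.Sketch

namespace Summit.ResolutionOfSingularities.ResolutionOfSingularities.Cruxes.SigmaMaxModificationsCorridor3.TameWild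

/-! ## Bodies -/

/-- `B(X, N)`: the seven-clause body of the crux at level `N` (CJS Def. 6.15 in modification
form; the route decl's inline `H^N` / `X_max` / `Σ_X` are `Scheme.hsFun / hsMaxLocus / hsValues`
by `rfl`). [cite: CossartJannsenSaito2020, Def. 6.15] -/
def HSBody (X : Scheme.{0}) (N : ℕ) : Prop :=
  ∃ (X' : Scheme.{0}) (π : X' ⟶ X), IsProper π ∧ IsReduced X' ∧
    topologicalKrullDim X' ≤ (N : WithBot ℕ∞) ∧
    (∀ U : X.Opens, (U : Set X) ⊆ (Scheme.hsMaxLocus X N)ᶜ → IsIso (π ∣_ U)) ∧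
    Dense ((fun x' => π.base x') ⁻¹' (Scheme.hsMaxLocus X N)ᶜ) ∧
    (∀ x' : X', Scheme.hsFun X' N x' ≤ Scheme.hsFun X N (π.base x')) ∧
    ∀ ν : ℕ → ℕ, Maximal (· ∈ Scheme.hsValues X N) ν → ν ∉ Scheme.hsValues X' N

/-- **`ν`-modification of `Y` at level `N` inside the class `{dim ≤ d}`** (CJS Def. 6.14 in
modification form = the hypothesis shape of the landed graded glue `stub_gradedGlue`): a proper
`π : Y' ⟶ Y`, `Y'` reduced with `dim Y' ≤ d`, `dim Y' ≤ N`, an isomorphism over every open inside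
`Y ∖ Y(ν)`, dense such opens pulled back to dense opens, `H^N` non-increasing, and `ν` no longer a
value of `Σ_{Y'}(N)`. [cite: CossartJannsenSaito2020, Def. 6.14, Rem. 6.24] -/
def NuMod (Y : Scheme.{0}) (N d : ℕ) (ν : ℕ → ℕ) : Prop :=
  ∃ (Y' : Scheme.{0}) (π : Y' ⟶ Y), IsProper π ∧ IsReduced Y' ∧
    topologicalKrullDim Y' ≤ (d : WithBot ℕ∞) ∧ topologicalKrullDim Y' ≤ (N : WithBot ℕ∞) ∧
    (∀ U : Y.Opens, (U : Set Y) ⊆ (Scheme.hsStratum Y N ν)ᶜ → IsIso (π ∣_ U)) ∧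
    (∀ U : Y.Opens, Dense (U : Set Y) → (U : Set Y) ⊆ (Scheme.hsStratum Y N ν)ᶜ →
      Dense ((π ⁻¹ᵁ U : Y'.Opens) : Set Y')) ∧
    (∀ y' : Y', Scheme.hsFun Y' N y' ≤ Scheme.hsFun Y N (π.base y')) ∧
    ν ∉ Scheme.hsValues Y' N

/-! ## The regime: `p`-tame maximal values -/

/-- **The Hilbert function of a hypersurface singularity of multiplicity `m` in embedding
dimension `4`:** `n ↦ C(n+3, 3) - C(n+3-m, 3)` `= Φ^{(4)}(n) - Φ^{(4)}(n - m)` (forms of degree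
`n` in four variables modulo the multiples of one form of degree `m`). By Bennett's normalisation
(CJS Def. 2.28: `H^N_X(x) = H^{(N - ψ_X(x))}(𝒪_{X,x})`) this is the level-`3` Hilbert–Samuel value
of EVERY point — closed or not, on a threefold or on a surface component — whose local ring is
`R/(g)` with `R` regular and `ord g = m`. [cite: CossartJannsenSaito2020, Def. 2.28, Thm. 2.3] -/
def hypersurfaceHF (m : ℕ) : ℕ → ℕ := fun n => (n + 3).choose 3 - (n + 3 - m).choose 3

/-- **`p`-tame value:** `ν` is the hypersurface Hilbert function of a multiplicity `m < p`. On the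
stratum `Y(ν)` of such a maximal value every local ring is a hypersurface singularity of
multiplicity `m < p` (the Hilbert function determines embedding dimension `= H(1) = 4` at level `3`
and the degree of the single tangent-cone equation), so Giraud's maximal contact (`ord < p`) exists
at every point of `Y(ν)` and at every near point above it. `m ≤ 1` never occurs for a maximal
value `≠ Φ^{(3)}` of a non-regular scheme (`hypersurfaceHF 1 = Φ^{(3)}`), so for `p = 2` no value
is tame. [cite: CossartJannsenSaito2020, Lemma 2.23, Thm. 2.3] -/
def IsTameValue (p : ℕ) (ν : ℕ → ℕ) : Prop := ∃ m : ℕ, m < p ∧ ν = hypersurfaceHF m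

/-! ## Stubs: printed theorems (named facts of the tree) -/

/-- **STUB (known in print): CJS `ν`-eliminations of reduced excellent surfaces** — the named
fact `CossartJannsenSaito2020_nuElimination` (Thm. 6.28 with Thm. 3.10 (1), Def. 6.14).
[cite: CossartJannsenSaito2020, Thm. 6.28, Def. 6.14] -/
theorem stub_cjsNuElimination : CossartJannsenSaito2020_nuElimination.{0} := by
  sorry

/-- **STUB (known in print): Cossart–Piltant 2019, Thm. 1.1** — the named fact
`CossartPiltant2019General`. [cite: CossartPiltant2019, Thm. 1.1] -/
theorem stub_cossartPiltant2019General : CossartPiltant2019General.{0} := by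
  sorry

/-! ## Stub: dimension-bounded level raising (provable; shared with line `corridor3_levels`) -/

/-- **STUB `stub_levelRaiseDim` (PROVABLE, M):** level raising `N → N + 1` on the class
`{dim ≤ d} ∩ {dim ≤ N}` — the proof of `levelRaise_succ` (p163333) verbatim, its hypothesis being
used only on an open `U₁ ⊆ X` with `dim U₁ ≤ dim X ≤ d`.
[cite: CossartJannsenSaito2020, Def. 6.15, Rem. 2.29 (b), Lemma 2.36] -/
theorem stub_levelRaiseDim :
    ∀ (k : Type) [Field k] (d N : ℕ),
      (∀ (Y : Scheme.{0}) (g : Y ⟶ Spec (.of k)), IsSeparated g → LocallyOfFiniteType g →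
        QuasiCompact g → IsReduced Y → ¬ Scheme.IsRegular Y →
        topologicalKrullDim Y ≤ (d : WithBot ℕ∞) → topologicalKrullDim Y ≤ (N : WithBot ℕ∞) →
        HSBody Y N) →
      ∀ (X : Scheme.{0}) (f : X ⟶ Spec (.of k)), IsSeparated f → LocallyOfFiniteType f →
        QuasiCompact f → IsReduced X → ¬ Scheme.IsRegular X →
        topologicalKrullDim X ≤ (d : WithBot ℕ∞) → topologicalKrullDim X ≤ (N : WithBot ℕ∞) →
        HSBody X (N + 1) := by
  sorry

/-! ## Stub: isolated strata (provable from Cossart–Piltant) -/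

/-- **STUB `stub_isolatedNu3` (PROVABLE from the named fact, M/L): `ν`-modification of an
ISOLATED maximal stratum in dimension `≤ 3`.** If `Y(ν)` is disjoint from
`closure (Sing Y ∖ Y(ν))`, resolve the open neighbourhood `V := Y ∖ closure (Sing Y ∖ Y(ν))` of
`Y(ν)` (on which `Sing V = Y(ν)`, as `ν ≠ Φ^{(3)}` puts `Y(ν)` inside `Sing Y`) by Cossart–Piltant
and glue with the identity of `Y ∖ Y(ν)` (`Y(ν)` is closed for a maximal `ν`): an isomorphism off
`Y(ν)`, regular above `Y(ν)` so `H^3` drops there and `ν` is killed, dense opens pulled back to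
dense opens because the resolution is an isomorphism over the dense `Reg V`. The ν-wise analogue of
the landed `sigmaMaxModifications_dim_le_three_of_isolated` (p154168).
[cite: CossartPiltant2019, Thm. 1.1] [cite: CossartJannsenSaito2020, Def. 6.14, Lemma 2.23] -/
theorem stub_isolatedNu3 :
    CossartPiltant2019General.{0} →
    ∀ (k : Type) [Field k] (Y : Scheme.{0}) (g : Y ⟶ Spec (.of k)), IsSeparated g →
      LocallyOfFiniteType g → QuasiCompact g → IsReduced Y →
      topologicalKrullDim Y ≤ ((3 : ℕ) : WithBot ℕ∞) →
      ∀ ν : ℕ → ℕ, Maximal (· ∈ Scheme.hsValues Y 3) ν → ν ≠ iterPSum 3 Phi →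
        Disjoint (closure ((Scheme.regularLocus Y)ᶜ \ Scheme.hsStratum Y 3 ν))
          (Scheme.hsStratum Y 3 ν) →
        NuMod Y 3 3 ν := by
  sorry

/-! ## Stub: the tame regime (TRANSFER from characteristic zero) -/

/-- **STUB `stub_tameNu3` (TRANSFER, XL — essentially in print): `ν`-modification of a `p`-TAME
non-isolated maximal stratum of a threefold over a PERFECT field.** `dim Y = 3`, `ν` maximal in
`Σ_Y(3)`, `ν = hypersurfaceHF m` with `m < p`. Route to a proof: (1) every point `y ∈ Y(ν)` has
`𝒪_{Y,y} ≅ R/(g)`, `R` regular, `ord g = m` (Hilbert function ⟹ embedding dimension `4` and a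
single tangent-cone equation of degree `m`), so locally `Y ↪ Z` regular fourfold (smooth: `k`
perfect) with `Y(ν) = top(g, m)`; (2) Giraud maximal contact for `(g, m)`, `m < p`
(`MarkedIdeal.exists_maximalContact_of_smooth`) and its persistence under blow-ups in centres
inside `top(g, m)` (`MaximalContactPersistence`), near points staying in the transforms of `W`
because `H` constant ⟹ `ord = m`; (3) Tschirnhausen (`m ∈ k^×`) and the coefficient marked ideal
`(C(g), m!)` on the regular threefold `W`: `Sing` and transforms correspond (char-free once
`∂_z^{(m-1)} g = m·z`); (4) resolution of `(C(g), m!)` on `W` over perfect `k` by blow-ups in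
regular centres inside `Sing` (CP 2008 Prop. 4.4 for `dim V ≤ 1`; Benito–Villamayor 2012 §4;
Kawanoue–Matsuki arXiv:1205.4556, ambient dimension 3) — these blow-ups are `H`-permissible for `Y`
(regular centres inside `Y(ν)`), `H^3` does not increase (CJS Thm. 3.10 (1)), and `ν` is killed when
`Sing = ∅`; (5) package the blow-up sequence as a `ν`-modification (`stub_centreSeq_package`
pattern of `SurfaceNuMods`). The non-isolation hypothesis is not used by this route (it only makes
the stub the exact complement of `stub_isolatedNu3`).
[cite: CossartJannsenSaito2020, Thm. 2.3, Lemma 2.23, Def. 6.14, Thm. 3.10]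
[cite: CossartPiltant2008, Prop. 4.4] -/
theorem stub_tameNu3 :
    ∀ p : ℕ, p.Prime → ∀ (k : Type) [Field k] [CharP k p] [PerfectField k] (Y : Scheme.{0})
      (g : Y ⟶ Spec (.of k)), IsSeparated g → LocallyOfFiniteType g → QuasiCompact g →
      IsReduced Y → ((3 : ℕ) : WithBot ℕ∞) ≤ topologicalKrullDim Y →
      topologicalKrullDim Y ≤ ((3 : ℕ) : WithBot ℕ∞) →
      ∀ ν : ℕ → ℕ, Maximal (· ∈ Scheme.hsValues Y 3) ν → ν ≠ iterPSum 3 Phi →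
        IsTameValue p ν →
        ¬ Disjoint (closure ((Scheme.regularLocus Y)ᶜ \ Scheme.hsStratum Y 3 ν))
            (Scheme.hsStratum Y 3 ν) →
        NuMod Y 3 3 ν := by
  sorry

/-! ## Stub: the wild residual (OPEN) -/

/-- **STUB `stub_wildNu3` (OPEN — the residual core): `ν`-modification of a WILD non-isolated
maximal stratum of a threefold.** `dim Y = 3`, `ν` maximal in `Σ_Y(3)`, and NOT (`k` perfect and
`ν` `p`-tame): the multiplicity is `≥ p`, or `ν` is not a hypersurface value (embedding dimension
`≥ 5`), or `k` is imperfect. This is where every catalogued characteristic-`p` pathology sits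
(Narasimhan `ν = p`, Moh–Hauser kangaroo points, Cossart–Schober small-`p` directrix) and nothing
is in print beyond CP 2019 (isomorphism over `Reg` only, excluded here by non-isolation and (ME1)).
For `p = 2` every maximal value is wild (CJS Rem. 6.29, obstruction O1).
[cite: CossartJannsenSaito2020, Rem. 6.29, Def. 6.14] [cite: CossartPiltant2019, §1] -/
theorem stub_wildNu3 :
    ∀ p : ℕ, p.Prime → ∀ (k : Type) [Field k] [CharP k p] (Y : Scheme.{0})
      (g : Y ⟶ Spec (.of k)), IsSeparated g → LocallyOfFiniteType g → QuasiCompact g →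
      IsReduced Y → ((3 : ℕ) : WithBot ℕ∞) ≤ topologicalKrullDim Y →
      topologicalKrullDim Y ≤ ((3 : ℕ) : WithBot ℕ∞) →
      ∀ ν : ℕ → ℕ, Maximal (· ∈ Scheme.hsValues Y 3) ν → ν ≠ iterPSum 3 Phi →
        ¬ (PerfectField k ∧ IsTameValue p ν) →
        ¬ Disjoint (closure ((Scheme.regularLocus Y)ᶜ \ Scheme.hsStratum Y 3 ν))
            (Scheme.hsStratum Y 3 ν) →
        NuMod Y 3 3 ν := by
  sorry

/-! ## Composition (sorry-free) -/

/-- **`ν`-modifications at level `3` on the class `{dim ≤ 3}`, by regime.** Surfaces: CJS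
(landed `stub_nuMods_surface_of_nuFact`); threefolds: isolated strata by Cossart–Piltant, tame
non-isolated strata by the transfer stub, wild ones by the residual stub.
[cite: CossartJannsenSaito2020, Def. 6.14, Thm. 6.28] [cite: CossartPiltant2019, Thm. 1.1] -/
theorem nuMod_three (p : ℕ) (hp : p.Prime) (k : Type) [Field k] [CharP k p] :
    ∀ (Y : Scheme.{0}) (g : Y ⟶ Spec (.of k)), IsSeparated g → LocallyOfFiniteType g →
      QuasiCompact g → IsReduced Y → topologicalKrullDim Y ≤ ((3 : ℕ) : WithBot ℕ∞) →
      topologicalKrullDim Y ≤ ((3 : ℕ) : WithBot ℕ∞) →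
      ∀ ν : ℕ → ℕ, Maximal (· ∈ Scheme.hsValues Y 3) ν → ν ≠ iterPSum 3 Phi →
        NuMod Y 3 3 ν := by
  intro Y g hsep hft hqc hred hd3 _ ν hν hνΦ
  rcases dim_le_or_succ_le (topologicalKrullDim Y) 2 with h2 | h3
  · -- surfaces (and curves) in the class: CJS ν-eliminations, raised to level `3`
    obtain ⟨Y', π, hπ, hred', hd2', hdN', hiso, hdense, hmono, hkill⟩ :=
      stub_nuMods_surface_of_nuFact stub_cjsNuElimination k 3 (by norm_num) Y g hsep hft hqc hred
        h2 hd3 ν hν hνΦ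
    exact ⟨Y', π, hπ, hred', hd2'.trans (by exact_mod_cast (by norm_num : (2 : ℕ) ≤ 3)), hdN',
      hiso, hdense, hmono, hkill⟩
  · -- threefolds
    by_cases hdisj : Disjoint (closure ((Scheme.regularLocus Y)ᶜ \ Scheme.hsStratum Y 3 ν))
        (Scheme.hsStratum Y 3 ν)
    · exact stub_isolatedNu3 stub_cossartPiltant2019General k Y g hsep hft hqc hred hd3 ν hν hνΦ
        hdisj
    · by_cases ht : PerfectField k ∧ IsTameValue p ν
      · haveI := ht.1
        exact stub_tameNu3 p hp k Y g hsep hft hqc hred (by exact_mod_cast h3) hd3 ν hν hνΦ ht.2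
          hdisj
      · exact stub_wildNu3 p hp k Y g hsep hft hqc hred (by exact_mod_cast h3) hd3 ν hν hνΦ ht
          hdisj

/-- **From `ν`-modifications to the body (landed graded glue + dense complement of `X_max`).**
[cite: CossartJannsenSaito2020, Def. 6.15, Rem. 6.24, Rem. 6.13] -/
theorem hsBody_of_nuMods (k : Type) [Field k] (N d : ℕ)
    (hmod : ∀ (Y : Scheme.{0}) (g : Y ⟶ Spec (.of k)), IsSeparated g → LocallyOfFiniteType g →
      QuasiCompact g → IsReduced Y → topologicalKrullDim Y ≤ (d : WithBot ℕ∞) →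
      topologicalKrullDim Y ≤ (N : WithBot ℕ∞) →
      ∀ ν : ℕ → ℕ, Maximal (· ∈ Scheme.hsValues Y N) ν → ν ≠ iterPSum N Phi → NuMod Y N d ν) :
    ∀ (X : Scheme.{0}) (f : X ⟶ Spec (.of k)), IsSeparated f → LocallyOfFiniteType f →
      QuasiCompact f → IsReduced X → ¬ Scheme.IsRegular X →
      topologicalKrullDim X ≤ (d : WithBot ℕ∞) → topologicalKrullDim X ≤ (N : WithBot ℕ∞) →
      HSBody X N := by
  intro X f hsep hft hqc hred hreg hdimd hdim
  obtain ⟨X', π, hπ, hred', hdim', hiso, hdense, hmono, hkill⟩ :=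
    stub_gradedGlue k N d hmod X f hsep hft hqc hred hreg hdimd hdim
  refine ⟨X', π, hπ, hred', hdim', hiso, ?_, hmono, hkill⟩
  haveI := hft
  haveI := hqc
  haveI := hred
  have hcl : IsClosed (Scheme.hsMaxLocus X N) :=
    (stub_isClosed_hsMaxLocus_over_field stub_hsFun_le_of_specializes_over_field k X f hft hqc N
      hdim).2
  have hd : Dense (Scheme.hsMaxLocus X N)ᶜ := stub_dense_compl_hsMaxLocus f hreg hdim
  exact hdense ⟨(Scheme.hsMaxLocus X N)ᶜ, hcl.isOpen_compl⟩ hd subset_rfl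

/-- **Every level on the class `{dim ≤ 3}`.** Induction on `N`: `dim X ≤ N - 1` by
`stub_levelRaiseDim` (`d = 3`); `dim X = N` a binding level — curves (landed), surfaces at level
`2` (graded glue of the CJS ν-fact, landed), threefolds at level `3` (`nuMod_three`).
[cite: CossartJannsenSaito2020, Def. 6.15, Rem. 2.29 (b)] -/
theorem hsBody_of_dim_le_three (p : ℕ) (hp : p.Prime) (k : Type) [Field k] [CharP k p] :
    ∀ (N : ℕ) (X : Scheme.{0}) (f : X ⟶ Spec (.of k)), IsSeparated f →
      LocallyOfFiniteType f → QuasiCompact f → IsReduced X → ¬ Scheme.IsRegular X →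
      topologicalKrullDim X ≤ ((3 : ℕ) : WithBot ℕ∞) → topologicalKrullDim X ≤ (N : WithBot ℕ∞) →
      HSBody X N := by
  intro N
  induction N with
  | zero =>
    intro X f hsep hft hqc hred hreg _ hdim
    exact stub_curve stub_curveResolution k X f hsep hft hqc hred hreg
      (hdim.trans (by exact_mod_cast (by omega : 0 ≤ 1))) 0 hdim
  | succ N ih =>
    intro X f hsep hft hqc hred hreg hd3 hdim
    rcases dim_le_or_succ_le (topologicalKrullDim X) N with h | h
    · exact stub_levelRaiseDim k 3 N ih X f hsep hft hqc hred hreg hd3 h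
    · have hN3 : N + 1 ≤ 3 := by exact_mod_cast h.trans hd3
      rcases Nat.lt_or_ge (N + 1) 2 with h1 | h2
      · exact stub_curve stub_curveResolution k X f hsep hft hqc hred hreg
          (hdim.trans (by exact_mod_cast (by omega : N + 1 ≤ 1))) (N + 1) hdim
      rcases h2.eq_or_lt with h2 | h3
      · -- surfaces at level `2`: graded glue of the CJS ν-eliminations (all landed)
        obtain rfl : N = 1 := by omega
        exact hsBody_of_nuMods k 2 2
          (fun Y g hsep hft hqc hred hd hd' ν hν hνΦ =>
            stub_nuMods_surface_of_nuFact stub_cjsNuElimination k 2 le_rfl Y g hsep hft hqc hred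
              hd hd' ν hν hνΦ)
          X f hsep hft hqc hred hreg hdim hdim
      · -- threefolds at level `3`
        obtain rfl : N = 2 := by omega
        exact hsBody_of_nuMods k 3 3 (nuMod_three p hp k) X f hsep hft hqc hred hreg hdim hdim

/-- **The crux from the stubs — THE REGISTERED COMPOSITION** (sorries only inside the six
`stub_*`). [cite: CossartJannsenSaito2020, Def. 6.15, Rem. 6.29] -/
theorem SigmaMaxModificationsCorridor3_of : SigmaMaxModificationsCorridor3 := by
  intro p hp k _ _ X f hsep hft hqc hred hreg _ h3' N hdim _ _
  exact hsBody_of_dim_le_three p hp k N X f hsep hft hqc hred hreg h3' hdim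

/-! ## Sanity of the regime predicate (sorry-free, `decide`-level) -/

/-- `hypersurfaceHF 1 = Φ^{(3)}` on an initial segment: multiplicity `1` is the regular value,
so a tame value of a non-regular stratum has `2 ≤ m < p` (in particular none for `p = 2`). -/
example : (List.range 8).map (hypersurfaceHF 1) = (List.range 8).map (iterPSum 3 Phi) := by
  decide

/-- The first values of the multiplicity-`2` and `-3` hypersurface functions
(`1, 4, 9, 16, …` and `1, 4, 10, 19, …`). -/
example : (List.range 5).map (hypersurfaceHF 2) = [1, 4, 9, 16, 25] ∧
    (List.range 5).map (hypersurfaceHF 3) = [1, 4, 10, 19, 31] := by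
  decide

end Summit.ResolutionOfSingularities.ResolutionOfSingularities.Cruxes.SigmaMaxModificationsCorridor3.TameWild

end
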